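import Summits.KontsevichZagierPeriods.KontsevichZagierPeriods.Theorems.MzvKernelInKZTwoPosetsDefs
import Summits.KontsevichZagierPeriods.KontsevichZagierPeriods.Theorems.MzvKernelInKZ.Negative.Transfer
import Summits.KontsevichZagierPeriods.KontsevichZagierPeriods.Theorems.MzvKernelInKZ.Negative.WeightsTwoThree
import Literature.NumberTheory.Transcendental.MultipleZetaStuffle
import Literature.NumberTheory.Transcendental.MZVWordShuffle
import Literature.NumberTheory.Transcendental.MZVShuffleRegularisation
import Literature.NumberTheory.Transcendental.KZProduct

/-!
# `MzvKernelInKZ` (stmt-KontsevichZagierPeriods-3914), line two-posets-interior-landen: the certificate-realisation transfer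

Registered stub `stub_transfer : TransferGlue` of the lead's skeleton
(`Cruxes/MzvKernelInKZ/Lines/two-posets-interior-landen.lean`): realisation bookkeeping
(`RealisationCompat`) + the move-chain families (shuffle and stuffle products, Hoffman's relation
in depth one and in depth `≥ 2`, duality from `Negative/Duality.lean`) + completeness of the
per-weight certificates (`EdsComplete`) + `ℚ`-independence of the real Hoffman values
(`HoffmanIndependent`) ⟹ the crux `MzvKernelInKZ`, through the disprover's all-weights transfer
engine `Negative.cruxAdm_of_family` / `Negative.crux_iff_cruxAdm`: each relation VECTOR of a
certificate realises to `0` in `KZ.FormalRep ⧸ KZ.relations` once its move chain exists, so a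
certificate identity `e_ε − ∑ a_h e_h = ∑ μ·(relation vectors)` becomes the spanning statement
"`[Δ, ω_ε] ≡ ∑_h [Δ, a_h ω_h]` modulo relations" that the engine consumes.

Sources: M. Kontsevich, D. Zagier, *Periods* (2001), §1.2; K. Ihara, M. Kaneko, D. Zagier,
Compos. Math. 142 (2006), §1; M. E. Hoffman, Pacific J. Math. 152 (1992), Thm 5.1; D. Zagier,
ECM 1992 (1994), §9.
-/

noncomputable section

namespace Summit.KontsevichZagierPeriods.MzvKernelInKZ.TwoPosets

open Set MeasureTheory
open Literature.NumberTheory.Transcendental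
open Summit.KontsevichZagierPeriods.MzvKernelInKZ.Negative
open Summit.KontsevichZagierPeriods.KontsevichZagierPeriods.Theses.LinRedNormalForm (MzvKernelInKZ)


/-! ## Words of indices -/

section Words

variable {N : ℕ}

/-- Reading a list of length `n` as a word of length `n` and back gives the list. -/
theorem ofFn_wordOf {L : List Bool} {n : ℕ} (h : L.length = n) : List.ofFn (wordOf n L) = L := by
  subst h
  apply List.ext_getElem (by simp)
  intro i h₁ h₂
  simp [wordOf, List.getD_eq_getElem?_getD, h₂]

/-- The word of an admissible index (read in its weight) has admissible letters. -/
theorem adm_bword {s : List ℕ} (hs : MZV.IsAdmissible s) : Adm (bword (MZV.weight s) s) := by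
  intro hw
  have hne : s ≠ [] := by rintro rfl; simp at hw
  have hlen : (MZV.binaryWord s).length = MZV.weight s := hs.length_binaryWord
  constructor
  · obtain ⟨a, s', rfl⟩ := List.exists_cons_of_ne_nil hne
    have ha : 2 ≤ a := hs.2 (List.cons_ne_nil a s')
    exact MZV.getD_binaryWord_cons_zero ha
  · obtain ⟨l, hl⟩ := MZV.exists_binaryWord_eq_append_true hne
    have hw' : MZV.weight s = l.length + 1 := by rw [← hlen, hl]; simp
    simp [bword, wordOf, hl, hw']

/-- The bracket of an index read in any `N` equal to its weight is its bracket `zIdx`. -/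
theorem zWord_bword_eq_zIdx {s : List ℕ} (h : MZV.weight s = N) (q : ℚ) :
    zWord N (bword N s) q = zIdx s q := by
  subst h; rfl

/-- The bracket of a word with admissible letters is the class of its canonical representation. -/
theorem zWord_of_adm {ε : Fin N → Bool} (h : Adm ε) (q : ℚ) :
    zWord N ε q = KZ.of (wordRep ε q h) := dif_pos h

/-- The bracket of a word with non-admissible letters is `0`. -/
theorem zWord_of_not_adm {ε : Fin N → Bool} (h : ¬ Adm ε) (q : ℚ) : zWord N ε q = 0 := dif_neg h

/-- The bracket of an admissible index is the class of its canonical word representation. -/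
theorem zIdx_of_adm {s : List ℕ} (hs : MZV.IsAdmissible s) (q : ℚ) :
    zIdx s q = KZ.of (wordRep (bword (MZV.weight s) s) q (adm_bword hs)) :=
  zWord_of_adm (adm_bword hs) q

end Words

/-! ## Realisation of the relation vectors -/

section Vanishing

variable {N : ℕ}

/-- The realisation map as an additive monoid morphism (from `RealisationCompat`). -/
theorem real_zero (hR : RealisationCompat) : real N (0 : Vec N) = 0 := by
  have h := hR.1 N 0 0
  rw [add_zero] at h
  exact left_eq_add.mp h

/-- Realisation of a difference. -/
theorem real_sub (hR : RealisationCompat) (v w : Vec N) : real N (v - w) = real N v - real N w := by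
  have h := hR.1 N (v - w) w
  rw [sub_add_cancel] at h
  exact eq_sub_of_add_eq h.symm

/-- Realisation of a list sum. -/
theorem real_list_sum (hR : RealisationCompat) (L : List (Vec N)) :
    real N L.sum = (L.map (real N)).sum := by
  induction L with
  | nil => simpa using real_zero hR
  | cons v L ih => rw [List.sum_cons, hR.1, ih, List.map_cons, List.sum_cons]

/-- Realisation of a finite sum. -/
theorem real_finset_sum (hR : RealisationCompat) {ι : Type*} (s : Finset ι) (f : ι → Vec N) :
    real N (∑ i ∈ s, f i) = ∑ i ∈ s, real N (f i) := by
  classical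
  induction s using Finset.induction_on with
  | empty => simpa using real_zero hR
  | insert a s ha ih => rw [Finset.sum_insert ha, Finset.sum_insert ha, hR.1, ih]

/-- Realisation of a rescaled unit vector: the bracket with that coefficient. -/
theorem real_smul_unitVec (hR : RealisationCompat) (q : ℚ) (ε : Fin N → Bool) :
    real N (q • unitVec N ε) = QuotientAddGroup.mk (zWord N ε q) := by
  rw [hR.2.1, hR.2.2.2, hR.2.2.1, mul_one]

/-- Realisation of the sum of unit vectors of a list of words. -/
theorem real_listVec (hR : RealisationCompat) (L : List (Fin N → Bool)) :
    real N (listVec N L) = (L.map fun ε => (QuotientAddGroup.mk (zWord N ε 1) :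
      KZ.FormalRep ⧸ KZ.relations)).sum := by
  rw [listVec, real_list_sum hR, List.map_map]
  congr 1
  exact List.map_congr_left fun ε _ => hR.2.2.2 N ε

/-- **Duality vectors realise to `0`** (one change-of-variables move, `Negative.duality_mem_relations`). -/
theorem real_dualVec (hR : RealisationCompat) (ε : Fin N → Bool) : real N (dualVec N ε) = 0 := by
  rw [dualVec, real_sub hR, hR.2.2.2, hR.2.2.2, sub_eq_zero]
  by_cases h : Adm ε
  · rw [zWord_of_adm h, zWord_of_adm (adm_dualWord h), QuotientAddGroup.eq_iff_sub_mem]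
    exact duality_mem_relations ε 1 h
  · have h' : ¬ Adm (dualWord ε) := fun h' => h (by simpa [dualWord_dualWord] using adm_dualWord h')
    rw [zWord_of_not_adm h, zWord_of_not_adm h']

/-- Realisation of the sum of unit vectors of a list of words, as one class. -/
theorem real_listVec' (hR : RealisationCompat) (L : List (Fin N → Bool)) :
    real N (listVec N L) = cls ((L.map fun ε => zWord N ε 1).sum) := by
  rw [real_listVec hR, map_list_sum, List.map_map]
  rfl

/-- **Finite double shuffle vectors realise to `0`**: both the shuffle sum and the stuffle sum are
congruent to the same product representation. -/
theorem real_fdsVec (hR : RealisationCompat) (hSh : ShuffleProductInKZ) (hSt : StuffleProductInKZ)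
    {s t : List ℕ} (hs : MZV.IsAdmissible s) (ht : MZV.IsAdmissible t) (hs0 : s ≠ []) (ht0 : t ≠ [])
    (hN : MZV.weight s + MZV.weight t = N) : real N (fdsVec N s t) = 0 := by
  subst hN
  have ha : 0 < MZV.weight s := by
    obtain ⟨a, s', rfl⟩ := List.exists_cons_of_ne_nil hs0
    have := hs.2 (List.cons_ne_nil a s')
    simp only [MZV.weight, List.sum_cons, List.head_cons] at this ⊢
    omega
  have hb : 0 < MZV.weight t := by
    obtain ⟨a, t', rfl⟩ := List.exists_cons_of_ne_nil ht0
    have := ht.2 (List.cons_ne_nil a t')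
    simp only [MZV.weight, List.sum_cons, List.head_cons] at this ⊢
    omega
  -- the shuffle half: `[s]·[t] ≡ ∑_{w ∈ ш} [w]`
  have h1 := hSh (MZV.weight s) (MZV.weight t) (bword _ s) (bword _ t) (adm_bword hs) (adm_bword ht)
    ha hb
  have e1 : List.ofFn (bword (MZV.weight s) s) = MZV.binaryWord s := ofFn_wordOf hs.length_binaryWord
  have e2 : List.ofFn (bword (MZV.weight t) t) = MZV.binaryWord t := ofFn_wordOf ht.length_binaryWord
  rw [e1, e2] at h1
  -- the stuffle half: `[s]·[t] ≡ ∑_{u ∈ ∗} [u]`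
  have h2 := hSt s t hs ht hs0 ht0
  rw [zIdx_of_adm hs, zIdx_of_adm ht] at h2
  have h2' : ((MZV.stuffle s t).map fun u => zIdx u 1) =
      (MZV.stuffle s t).map fun u => zWord (MZV.weight s + MZV.weight t)
        (bword (MZV.weight s + MZV.weight t) u) 1 := by
    refine List.map_congr_left fun u hu => ?_
    rw [zWord_bword_eq_zIdx]
    exact MZV.sum_of_mem_stuffle s t hu
  rw [h2'] at h2
  -- in the quotient
  rw [fdsVec, real_sub hR, real_listVec' hR, real_listVec' hR, List.map_map, List.map_map, sub_eq_zero,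
    cls_eq_cls_iff]
  have : ((MZV.shuffleWord (MZV.binaryWord s) (MZV.binaryWord t)).map
        ((fun ε => zWord (MZV.weight s + MZV.weight t) ε 1) ∘ wordOf (MZV.weight s + MZV.weight t))).sum -
      ((MZV.stuffle s t).map ((fun ε => zWord (MZV.weight s + MZV.weight t) ε 1) ∘
        bword (MZV.weight s + MZV.weight t))).sum =
      (KZ.of (wordRep (bword (MZV.weight s) s) 1 (adm_bword hs)) *
          KZ.of (wordRep (bword (MZV.weight t) t) 1 (adm_bword ht)) -
        ((MZV.stuffle s t).map ((fun ε => zWord (MZV.weight s + MZV.weight t) ε 1) ∘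
          bword (MZV.weight s + MZV.weight t))).sum) -
      (KZ.of (wordRep (bword (MZV.weight s) s) 1 (adm_bword hs)) *
          KZ.of (wordRep (bword (MZV.weight t) t) 1 (adm_bword ht)) -
        ((MZV.shuffleWord (MZV.binaryWord s) (MZV.binaryWord t)).map
          ((fun ε => zWord (MZV.weight s + MZV.weight t) ε 1) ∘
            wordOf (MZV.weight s + MZV.weight t))).sum) := by abel
  rw [this]
  exact sub_mem h2 h1

/-- The depth-one instance `s = (k)`, `k = 2`, of Hoffman's relation is duality `ζ(3) = ζ(2,1)`. -/
theorem bword_three : bword 3 [3] = ω3 := by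
  funext i; fin_cases i <;> rfl

/-- The word of the index `(2,1)` read in weight `3`. -/
theorem bword_two_one : bword 3 [2, 1] = ω21 := by
  funext i; fin_cases i <;> rfl

/-- Weight bookkeeping for the indices on the left of Hoffman's relation. -/
theorem weight_take_add_one_drop {s : List ℕ} (l : Fin s.length) :
    MZV.weight (s.take l.1 ++ [s.get l + 1] ++ s.drop (l.1 + 1)) = MZV.weight s + 1 := by
  have h : s = s.take l.1 ++ [s.get l] ++ s.drop (l.1 + 1) := by
    rw [List.get_eq_getElem, List.append_assoc, List.singleton_append,
      ← List.drop_eq_getElem_cons l.2, List.take_append_drop]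
  conv_rhs => rw [h]
  simp only [MZV.weight, List.sum_append, List.sum_cons, List.sum_nil]
  ring

/-- Weight bookkeeping for the indices on the right of Hoffman's relation. -/
theorem weight_take_sub_drop {s : List ℕ} (l : Fin s.length) {j : ℕ} (hj : j < s.get l - 1) :
    MZV.weight (s.take l.1 ++ [s.get l - j, j + 1] ++ s.drop (l.1 + 1)) = MZV.weight s + 1 := by
  have h : s = s.take l.1 ++ [s.get l] ++ s.drop (l.1 + 1) := by
    rw [List.get_eq_getElem, List.append_assoc, List.singleton_append,
      ← List.drop_eq_getElem_cons l.2, List.take_append_drop]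
  conv_rhs => rw [h]
  simp only [MZV.weight, List.sum_append, List.sum_cons, List.sum_nil]
  omega

/-- **Hoffman relation vectors realise to `0`**: depth `≥ 2` by `HoffmanDeepInKZ`, depth one by
`HoffmanDepthOneInKZ` (`k ≥ 3`) or duality (`k = 2`), depth zero trivially. -/
theorem real_hoffmanVec (hR : RealisationCompat) (hH1 : HoffmanDepthOneInKZ) (hHd : HoffmanDeepInKZ)
    {s : List ℕ} (hs : MZV.IsAdmissible s) (hN : MZV.weight s + 1 = N) :
    real N (hoffmanVec N s) = 0 := by
  subst hN
  -- realise both sums as classes of sums of `zIdx`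
  have hL : ∀ l : Fin s.length,
      real (MZV.weight s + 1) (unitVec _ (bword _ (s.take l.1 ++ [s.get l + 1] ++ s.drop (l.1 + 1)))) =
        cls (zIdx (s.take l.1 ++ [s.get l + 1] ++ s.drop (l.1 + 1)) 1) := by
    intro l
    rw [hR.2.2.2, ← zWord_bword_eq_zIdx (weight_take_add_one_drop l)]
    rfl
  have hRgt : ∀ l : Fin s.length, ∀ j ∈ Finset.range (s.get l - 1),
      real (MZV.weight s + 1)
          (unitVec _ (bword _ (s.take l.1 ++ [s.get l - j, j + 1] ++ s.drop (l.1 + 1)))) =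
        cls (zIdx (s.take l.1 ++ [s.get l - j, j + 1] ++ s.drop (l.1 + 1)) 1) := by
    intro l j hj
    rw [hR.2.2.2, ← zWord_bword_eq_zIdx (weight_take_sub_drop l (Finset.mem_range.mp hj))]
    rfl
  rw [hoffmanVec, real_sub hR, real_finset_sum hR, real_finset_sum hR, sub_eq_zero,
    Finset.sum_congr rfl fun l _ => hL l,
    Finset.sum_congr rfl fun l _ => (real_finset_sum hR _ _).trans (Finset.sum_congr rfl (hRgt l)),
    ← map_sum]
  simp_rw [← map_sum]
  rw [cls_eq_cls_iff]
  -- case analysis on the depth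
  rcases Nat.lt_or_ge s.length 2 with hlt | hge
  · -- depth ≤ 1
    match s, hs, hlt with
    | [], _, _ => simp
    | [k], hs, _ =>
      have hk : 2 ≤ k := hs.2 (List.cons_ne_nil k [])
      simp only [List.length_singleton, Fin.sum_univ_one, List.take_zero,
        List.nil_append, List.get_eq_getElem, Fin.coe_ofNat_eq_mod, Nat.zero_mod,
        List.getElem_cons_zero, List.drop_succ_cons, List.drop_zero, List.append_nil]
      rcases Nat.lt_or_ge k 3 with hk3 | hk3
      · -- `k = 2`: duality
        obtain rfl : k = 2 := by omega
        simp only [show (2 : ℕ) - 1 = 1 from rfl, Finset.range_one, Finset.sum_singleton,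
          Nat.sub_zero, zero_add]
        rw [zIdx_of_adm (by decide : MZV.IsAdmissible [3]), zIdx_of_adm (by decide : MZV.IsAdmissible [2, 1])]
        have e3 : wordRep (bword (MZV.weight [3]) [3]) 1 (adm_bword (by decide)) = wordRep ω3 1 adm_ω3 :=
          wordRep_congr bword_three 1 _ _
        have e21 : wordRep (bword (MZV.weight [2, 1]) [2, 1]) 1 (adm_bword (by decide)) =
            wordRep ω21 1 adm_ω21 := wordRep_congr bword_two_one 1 _ _
        rw [e3, e21]
        have h := KZ.relations.neg_mem cDual3_mem_relations
        rwa [cDual3, neg_sub] at h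
      · exact hH1 k hk3
  · exact hHd s hs hge

end Vanishing

/-! ## The transfer -/

section Transfer

/-- **Registered stub `stub_transfer`**: the certificate-realisation transfer. -/
theorem stub_transfer : TransferGlue := by
  intro hR _hC _hL hH1 hSh hSt hHd hE hHI
  classical
  -- the Hoffman base family
  let ι := {s : List ℕ // MZV.IsHoffman s}
  let B : ∀ j : ι, Fin (MZV.weight j.1) → Bool := fun j => bword (MZV.weight j.1) j.1
  have hB : ∀ j : ι, Adm (B j) := fun j => adm_bword j.2.isAdmissible
  refine crux_iff_cruxAdm.mpr (cruxAdm_of_family B hB ?_ ?_)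
  · -- independence of the values = `HoffmanIndependent`
    have hval : (fun j : ι => (wordRep (B j) 1 (hB j)).value) = fun j : ι => multipleZeta j.1 := by
      funext j
      exact value_wordRep_eq_multipleZeta j.1 j.2.isAdmissible (B j) (hB j) fun _ => rfl
    rw [hval]
    exact hHI
  · -- spanning inside the calculus, from the certificates
    intro w ε hε
    obtain ⟨H, F, D, K, hH, hF, hD, hK, heq⟩ := hE w ε hε
    have hreal := congrArg (real w) heq
    -- the right-hand side realises to `0`
    have hF0 : real w (F.map fun p => p.2 • fdsVec w p.1.1 p.1.2).sum = 0 := by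
      rw [real_list_sum hR, List.map_map]
      refine List.sum_eq_zero fun x hx => ?_
      obtain ⟨p, hp, rfl⟩ := List.mem_map.mp hx
      obtain ⟨h1, h2, h3, h4, h5⟩ := hF p hp
      simp only [Function.comp_apply]
      rw [hR.2.1, real_fdsVec hR hSh hSt h1 h2 h3 h4 h5, map_zero]
    have hD0 : real w (D.map fun p => p.2 • hoffmanVec w p.1).sum = 0 := by
      rw [real_list_sum hR, List.map_map]
      refine List.sum_eq_zero fun x hx => ?_
      obtain ⟨p, hp, rfl⟩ := List.mem_map.mp hx
      obtain ⟨h1, h2⟩ := hD p hp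
      simp only [Function.comp_apply]
      rw [hR.2.1, real_hoffmanVec hR hH1 hHd h1 h2, map_zero]
    have hK0 : real w (K.map fun p => p.2 • dualVec w p.1).sum = 0 := by
      rw [real_list_sum hR, List.map_map]
      refine List.sum_eq_zero fun x hx => ?_
      obtain ⟨p, _, rfl⟩ := List.mem_map.mp hx
      simp only [Function.comp_apply]
      rw [hR.2.1, real_dualVec hR, map_zero]
    rw [hR.1, hR.1, hF0, hD0, hK0, add_zero, add_zero, real_sub hR, sub_eq_zero, hR.2.2.2,
      zWord_of_adm hε, real_list_sum hR, List.map_map] at hreal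
    -- the coefficient vector on the Hoffman family
    let a : ι →₀ ℚ := (H.attach.map fun p => Finsupp.single ⟨p.1.1, (hH p.1 p.2).1⟩ p.1.2).sum
    refine ⟨a, ?_⟩
    rw [← cls_eq_cls_iff, cls_finsuppSum, map_list_sum, List.map_map]
    change cls (KZ.of (wordRep ε 1 hε)) = _ at hreal
    rw [hreal, show H.map (real w ∘ fun p => p.2 • unitVec w (bword w p.1)) =
        H.attach.map (fun p => real w (p.1.2 • unitVec w (bword w p.1.1))) from
      List.attach_map_val.symm]
    congr 1
    refine List.map_congr_left fun p _ => ?_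
    simp only [Function.comp_apply, nfHom, Finsupp.liftAddHom_apply_single, coefHom_apply]
    rw [real_smul_unitVec hR, zWord_bword_eq_zIdx (hH p.1 p.2).2, zIdx_of_adm (hH p.1 p.2).1.isAdmissible]
    rfl

/-- **Landen-free transfer**: the content of `stub_transfer` (whose cubical-chart and interior-Landen
arguments its proof never uses), so that both Hoffman inputs may come from item 3930 directly. -/
theorem transferCore : RealisationCompat → HoffmanDepthOneInKZ → ShuffleProductInKZ → StuffleProductInKZ → HoffmanDeepInKZ → EdsComplete → HoffmanIndependent → Summit.KontsevichZagierPeriods.KontsevichZagierPeriods.Theses.LinRedNormalForm.MzvKernelInKZ := by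
  intro hR hH1 hSh hSt hHd hE hHI
  classical
  -- the Hoffman base family
  let ι := {s : List ℕ // MZV.IsHoffman s}
  let B : ∀ j : ι, Fin (MZV.weight j.1) → Bool := fun j => bword (MZV.weight j.1) j.1
  have hB : ∀ j : ι, Adm (B j) := fun j => adm_bword j.2.isAdmissible
  refine crux_iff_cruxAdm.mpr (cruxAdm_of_family B hB ?_ ?_)
  · -- independence of the values = `HoffmanIndependent`
    have hval : (fun j : ι => (wordRep (B j) 1 (hB j)).value) = fun j : ι => multipleZeta j.1 := by
      funext j
      exact value_wordRep_eq_multipleZeta j.1 j.2.isAdmissible (B j) (hB j) fun _ => rfl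
    rw [hval]
    exact hHI
  · -- spanning inside the calculus, from the certificates
    intro w ε hε
    obtain ⟨H, F, D, K, hH, hF, hD, hK, heq⟩ := hE w ε hε
    have hreal := congrArg (real w) heq
    -- the right-hand side realises to `0`
    have hF0 : real w (F.map fun p => p.2 • fdsVec w p.1.1 p.1.2).sum = 0 := by
      rw [real_list_sum hR, List.map_map]
      refine List.sum_eq_zero fun x hx => ?_
      obtain ⟨p, hp, rfl⟩ := List.mem_map.mp hx
      obtain ⟨h1, h2, h3, h4, h5⟩ := hF p hp
      simp only [Function.comp_apply]
      rw [hR.2.1, real_fdsVec hR hSh hSt h1 h2 h3 h4 h5, map_zero]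
    have hD0 : real w (D.map fun p => p.2 • hoffmanVec w p.1).sum = 0 := by
      rw [real_list_sum hR, List.map_map]
      refine List.sum_eq_zero fun x hx => ?_
      obtain ⟨p, hp, rfl⟩ := List.mem_map.mp hx
      obtain ⟨h1, h2⟩ := hD p hp
      simp only [Function.comp_apply]
      rw [hR.2.1, real_hoffmanVec hR hH1 hHd h1 h2, map_zero]
    have hK0 : real w (K.map fun p => p.2 • dualVec w p.1).sum = 0 := by
      rw [real_list_sum hR, List.map_map]
      refine List.sum_eq_zero fun x hx => ?_
      obtain ⟨p, _, rfl⟩ := List.mem_map.mp hx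
      simp only [Function.comp_apply]
      rw [hR.2.1, real_dualVec hR, map_zero]
    rw [hR.1, hR.1, hF0, hD0, hK0, add_zero, add_zero, real_sub hR, sub_eq_zero, hR.2.2.2,
      zWord_of_adm hε, real_list_sum hR, List.map_map] at hreal
    -- the coefficient vector on the Hoffman family
    let a : ι →₀ ℚ := (H.attach.map fun p => Finsupp.single ⟨p.1.1, (hH p.1 p.2).1⟩ p.1.2).sum
    refine ⟨a, ?_⟩
    rw [← cls_eq_cls_iff, cls_finsuppSum, map_list_sum, List.map_map]
    change cls (KZ.of (wordRep ε 1 hε)) = _ at hreal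
    rw [hreal, show H.map (real w ∘ fun p => p.2 • unitVec w (bword w p.1)) =
        H.attach.map (fun p => real w (p.1.2 • unitVec w (bword w p.1.1))) from
      List.attach_map_val.symm]
    congr 1
    refine List.map_congr_left fun p _ => ?_
    simp only [Function.comp_apply, nfHom, Finsupp.liftAddHom_apply_single, coefHom_apply]
    rw [real_smul_unitVec hR, zWord_bword_eq_zIdx (hH p.1 p.2).2, zIdx_of_adm (hH p.1 p.2).1.isAdmissible]
    rfl


end Transfer

end Summit.KontsevichZagierPeriods.MzvKernelInKZ.TwoPosets
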